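import Literature.Computability.QuantumComplexity.Lemma24Catalysis
import Literature.Computability.QuantumComplexity.Lemma24Gadget
import Literature.Computability.QuantumComplexity.StabilizerSimulationProofs
import HarnessLib

/-!
# Aaronson–Ambainis Lemma 24 over the sign basis, VI: the two catalyst branches and the gadget's weight

Sixth file of the discharge of `AaronsonAmbainis2018_lemma24_sign_hard` (plan in
`Lemma24Catalysis.lean`). The catalyst and helper qubits `(cat, h)` sit behind the working register
(`tensorVec`, working register first); after the projector calculus of file I the ideal state is
`Θ_T ⊗ Π_A γ + Θ_{ZT} ⊗ Π_⊥ γ` with the two small factors orthogonal, so the Born weight of any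
event read off the working register splits into the two branches weighted by
`w_A = ‖Π_A γ‖²` and `w_⊥ = ‖Π_⊥ γ‖²` (Nielsen–Chuang 2010, §2.2.8; this is the whole error analysis
of the reduction — the error does not accumulate). Here `γ` is the complex two-qubit state whose
realification is the output of the gadget of file III.

* `sum_qReg_add`, `tensorVec_append` — sums over and amplitudes of `QReg (a + b)` through
  `Fin.appendEquiv`;
* **`sum_ite_normSq_tensorVec_add`** — the branch split for orthogonal small factors;
* `gamma` — the gadget state read as a complex state of `(cat, h)` (`gadgetVec_eq_gamma`:
  wire `ρ` of the gadget carries real/imaginary parts), `normSq_gamma = 1`;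
* the projected states `branchA = Π_A γ`, `branchPerp = Π_⊥ γ` (with `ω = (√2/2)(1 + i)` from the
  tree's `omega_eq_sqrt`), their orthogonality `sum_star_branchA_mul_branchPerp = 0`,
  `normSq_branchA_add = 1`, and **`normSq_branchPerp_le : w_⊥ ≤ 3/1000`**
  (exact value `1/2 − 45√2/128 ≈ 0.0028`).

## References

* S. Aaronson, A. Ambainis, *Forrelation*, SIAM J. Comput. 47 (2018), §6, Lemma 24 (p. 26).
* M. A. Nielsen, I. L. Chuang, *Quantum Computation and Quantum Information*, CUP 2010, §2.1.7,
  §2.2.8 (composite systems), §10.6.2 (the magic state of `T`).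
-/

noncomputable section

namespace Literature.Computability.QuantumComplexity

open Matrix _root_.Computability Complexity Cryptography Finset

namespace Lemma24

variable {a b : ℕ}

/-! ### Registers `QReg (a + b)`: sums and product amplitudes -/

/-- Sums over `QReg (a + b)` are double sums over the two parts (`Fin.appendEquiv`).
[cite: NielsenChuang2010, §2.1.7] -/
theorem sum_qReg_add {M : Type*} [AddCommMonoid M] (F : QReg (a + b) → M) :
    ∑ z, F z = ∑ u : QReg a, ∑ y : QReg b, F (Fin.append u y) := by
  rw [← Fintype.sum_prod_type', ← (Fin.appendEquiv a b).sum_comp]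
  rfl

/-- The amplitude of a product state at a concatenated label. [cite: NielsenChuang2010, §2.1.7] -/
theorem tensorVec_append (ψ : QReg a → ℂ) (φ : QReg b → ℂ) (u : QReg a) (y : QReg b) :
    tensorVec ψ φ (Fin.append u y) = ψ u * φ y := by
  rw [tensorVec_apply]
  congr 1
  · congr 1; funext i; exact Fin.append_left u y i
  · congr 1; funext j; exact Fin.append_right u y j

/-- The first part of a concatenated label. [folklore] -/
theorem append_comp_castAdd (u : QReg a) (y : QReg b) : (fun i => Fin.append u y (Fin.castAdd b i)) = u :=
  funext fun i => Fin.append_left u y i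

/-! ### The branch split -/

/-- `Σ_y |s α(y) + t β(y)|² = |s|² ‖α‖² + |t|² ‖β‖²` for orthogonal `α ⊥ β`. [cite: NielsenChuang2010, §2.2.8] -/
theorem sum_norm_sq_smul_add_smul {α β : QReg b → ℂ} (horth : ∑ y, star (α y) * β y = 0) (s t : ℂ) :
    (∑ y, ‖s * α y + t * β y‖ ^ 2) = ‖s‖ ^ 2 * normSq α + ‖t‖ ^ 2 * normSq β := by
  have horth' : ∑ y, α y * star (β y) = 0 := by
    have := congrArg star horth
    rw [star_sum, star_zero] at this
    rw [← this]
    exact Finset.sum_congr rfl fun y _ => by rw [star_mul', star_star, mul_comm]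
  have key : ∀ y, ‖s * α y + t * β y‖ ^ 2 =
      ‖s‖ ^ 2 * ‖α y‖ ^ 2 + ‖t‖ ^ 2 * ‖β y‖ ^ 2 + 2 * (s * star t * (α y * star (β y))).re := by
    intro y
    rw [Complex.sq_norm, Complex.sq_norm, Complex.sq_norm, Complex.sq_norm, Complex.sq_norm, Complex.normSq_add,
      Complex.normSq_mul, Complex.normSq_mul]
    congr 1
    congr 1
    simp only [map_mul, Complex.star_def]
    ring_nf
  simp_rw [key]
  rw [Finset.sum_add_distrib, Finset.sum_add_distrib, ← Finset.mul_sum, ← Finset.mul_sum, normSq, normSq,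
    ← Finset.mul_sum, ← Complex.re_sum, ← Finset.mul_sum, horth', mul_zero, Complex.zero_re, mul_zero, add_zero]

/-- **The branch split.** For small factors `α ⊥ β` behind the working register, the Born weight of
an event `ev` read off the working register in `Θ₁ ⊗ α + Θ₂ ⊗ β` is
`‖α‖² · P_{Θ₁}(ev) + ‖β‖² · P_{Θ₂}(ev)`. [cite: NielsenChuang2010, §2.2.8] -/
theorem sum_ite_normSq_tensorVec_add (Θ₁ Θ₂ : QReg a → ℂ) {α β : QReg b → ℂ}
    (horth : ∑ y, star (α y) * β y = 0) (ev : QReg a → Prop) [DecidablePred ev] :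
    (∑ z : QReg (a + b), if ev (fun i => z (Fin.castAdd b i)) then ‖(tensorVec Θ₁ α + tensorVec Θ₂ β) z‖ ^ 2 else 0) =
      normSq α * (∑ u, if ev u then ‖Θ₁ u‖ ^ 2 else 0) + normSq β * (∑ u, if ev u then ‖Θ₂ u‖ ^ 2 else 0) := by
  rw [sum_qReg_add, Finset.mul_sum, Finset.mul_sum, ← Finset.sum_add_distrib]
  refine Finset.sum_congr rfl fun u _ => ?_
  simp only [append_comp_castAdd]
  by_cases hu : ev u
  · simp only [if_pos hu, Pi.add_apply, tensorVec_append]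
    rw [sum_norm_sq_smul_add_smul horth]
    ring
  · simp [if_neg hu]

/-! ### The gadget state as a complex state of `(cat, h)` -/

/-- **The gadget state, complex**: `γ(c, h) = g(c, 0, h) + i g(c, 1, h)` where `g` is the real output
`gadgetVec` of the gadget on the wires `(cat, ρ, h)` — the wire `ρ` carries real and imaginary parts.
Values: `γ = ((3 − 3i)|00⟩ + (−3 + 2i)|01⟩ + 4|10⟩ + (−4 − i)|11⟩)/8`. [cite: NielsenChuang2010, §10.6.2] -/
def gamma : QReg 2 → ℂ := fun y =>
  (gadgetInt (y 0) false (y 1) : ℂ) / 8 + (gadgetInt (y 0) true (y 1) : ℂ) / 8 * Complex.I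

/-- The gadget's real output is the realification pattern of `γ` with `ρ` as the middle wire:
`g(c, r, h) = vecEntry (γ (c, h)) r`-style, spelled out. [cite: NielsenChuang2010, §10.6.2] -/
theorem gadgetVec_eq_gamma (c r hh : Bool) :
    gadgetVec ![c, r, hh] = if r then ((gamma ![c, hh]).im : ℂ) else ((gamma ![c, hh]).re : ℂ) := by
  cases c <;> cases r <;> cases hh <;> simp [gadgetVec, gadgetInt, gamma]

/-- `γ` is a unit vector (`9 + 9 + 9 + 4 + 16 + 16 + 1 = 64`). [folklore] -/
theorem normSq_gamma : normSq gamma = 1 := by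
  rw [normSq, sum_qReg_two]
  simp only [Fintype.sum_bool, gamma, gadgetInt, Matrix.cons_val_zero, Matrix.cons_val_one,
    Complex.sq_norm, Complex.normSq_apply, Complex.add_re, Complex.add_im, Complex.div_ofNat_re,
    Complex.div_ofNat_im, Complex.mul_re, Complex.mul_im, Complex.I_re, Complex.I_im, Complex.intCast_re,
    Complex.intCast_im]
  norm_num

/-! ### The two branches of the gadget state -/

/-- The `|A⟩`-branch `Π_A γ` (projector on the catalyst wire, the first of the two). [cite: NielsenChuang2010, §10.6.2] -/
def branchA : QReg 2 → ℂ := placeGate (wireEmb (0 : Fin 2)) projA *ᵥ gamma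

/-- The `|A⊥⟩`-branch `Π_⊥ γ`. [cite: NielsenChuang2010, §10.6.2] -/
def branchPerp : QReg 2 → ℂ := placeGate (wireEmb (0 : Fin 2)) projAperp *ᵥ gamma

/-- The two branches recompose `γ`. [cite: NielsenChuang2010, §2.1.6 (completeness)] -/
theorem branchA_add_branchPerp : branchA + branchPerp = gamma := by
  rw [branchA, branchPerp, ← Matrix.add_mulVec, ← placeGate_add, projA_add_projAperp, placeGate_one, Matrix.one_mulVec]
  where
  /-- Placement is additive. [folklore] -/
  placeGate_add {k N : ℕ} (e : Fin k ↪ Fin N) (U V : Matrix (QReg k) (QReg k) ℂ) :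
      placeGate e (U + V) = placeGate e U + placeGate e V := by
    ext x y; simp only [placeGate_apply, Matrix.add_apply]; split_ifs <;> simp

/-- A placed projector on the first wire, entrywise: `(Π_P γ)(c, h) = Σ_{c'} P(c, c') γ(c', h)`. [cite: NielsenChuang2010, §4.3] -/
theorem placeGate_first_mulVec_apply (P : Matrix (QReg 1) (QReg 1) ℂ) (φ : QReg 2 → ℂ) (c hh : Bool) :
    (placeGate (wireEmb (0 : Fin 2)) P *ᵥ φ) ![c, hh] =
      P (fun _ => c) (fun _ => false) * φ ![false, hh] + P (fun _ => c) (fun _ => true) * φ ![true, hh] := by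
  rw [placeGate_mulVec_apply, sum_qReg_one, Fintype.sum_bool, extend_fin_one, extend_fin_one, add_comm]
  have h0 : (![c, hh] : QReg 2) ∘ wireEmb (0 : Fin 2) = fun _ => c := funext fun _ => by simp
  have hu : ∀ v : Bool, Function.update (![c, hh] : QReg 2) (wireEmb (0 : Fin 2) 0) v = ![v, hh] := fun v => by
    funext i; fin_cases i <;> simp
  rw [h0, hu, hu]

/-- **The branches are orthogonal**: `⟨Π_A γ, Π_⊥ γ⟩ = 0` (`Π_A Π_⊥ = 0`, both self-adjoint).
[cite: NielsenChuang2010, §2.1.6] -/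
theorem sum_star_branchA_mul_branchPerp : ∑ y, star (branchA y) * branchPerp y = 0 := by
  have h : star branchA ⬝ᵥ branchPerp = 0 := by
    rw [branchA, branchPerp, Matrix.star_mulVec, ← Matrix.dotProduct_mulVec, Matrix.mulVec_mulVec, ← star_eq_conjTranspose]
    have hsa : star (placeGate (wireEmb (0 : Fin 2)) projA) = placeGate (wireEmb (0 : Fin 2)) projA := by
      rw [star_eq_conjTranspose, placeGate_conjTranspose, projA_conjTranspose]
    rw [hsa, ← placeGate_mul_holds, projA_mul_projAperp, placeGate_zero, Matrix.zero_mulVec, dotProduct_zero]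
  simpa [dotProduct] using h
  where
  /-- Placement commutes with the adjoint. [folklore] -/
  placeGate_conjTranspose {k N : ℕ} (e : Fin k ↪ Fin N) (U : Matrix (QReg k) (QReg k) ℂ) :
      (placeGate e U)ᴴ = placeGate e Uᴴ := by
    ext x y
    simp only [Matrix.conjTranspose_apply, placeGate_apply]
    by_cases h : ∀ i, i ∉ Set.range e → y i = x i
    · rw [if_pos h, if_pos fun i hi => (h i hi).symm]
    · rw [if_neg h, if_neg fun h' => h fun i hi => (h' i hi).symm, star_zero]
  /-- Placement of the zero matrix. [folklore] -/
  placeGate_zero {k N : ℕ} (e : Fin k ↪ Fin N) : placeGate e (0 : Matrix (QReg k) (QReg k) ℂ) = 0 := by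
    ext x y; simp [placeGate_apply]

/-- **The branch weights sum to one**: `‖Π_A γ‖² + ‖Π_⊥ γ‖² = 1`. [cite: NielsenChuang2010, §2.2.8] -/
theorem normSq_branchA_add : normSq branchA + normSq branchPerp = 1 := by
  have h := sum_norm_sq_smul_add_smul (b := 2) sum_star_branchA_mul_branchPerp 1 1
  simp only [one_mul, norm_one, one_pow] at h
  rw [← h, ← normSq_gamma, normSq]
  refine Finset.sum_congr rfl fun y _ => ?_
  rw [← branchA_add_branchPerp]; rfl

/-- The overlap `Z = Σ_h γ̄(0,h) γ(1,h) = (22 + 23i)/64` of the two catalyst rows of `γ`. [folklore] -/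
theorem gamma_overlap :
    star (gamma ![false, false]) * gamma ![true, false] + star (gamma ![false, true]) * gamma ![true, true] =
      (22 + 23 * Complex.I) / 64 := by
  apply Complex.ext <;>
    simp [gamma, gadgetInt, Complex.mul_re, Complex.mul_im, Complex.div_ofNat_re,
      Complex.div_ofNat_im] <;> norm_num

/-- **The weight of the `|A⊥⟩`-branch**: `‖Π_⊥ γ‖² = 1/2 − 45√2/128`. [cite: NielsenChuang2010, §10.6.2] -/
theorem normSq_branchPerp_eq : normSq branchPerp = 1 / 2 - 45 * Real.sqrt 2 / 128 := by
  -- `(Π_⊥ γ)(c, h) = |A⊥⟩(c) · s_h` with `s_h = ⟨A⊥| γ(·, h)⟩`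
  have hent : ∀ c hh : Bool, branchPerp ![c, hh] =
      ketAperp (fun _ => c) * (star (ketAperp fun _ => false) * gamma ![false, hh] +
        star (ketAperp fun _ => true) * gamma ![true, hh]) := by
    intro c hh
    rw [branchPerp, placeGate_first_mulVec_apply]
    simp only [projAperp, Matrix.of_apply]
    ring
  rw [normSq, sum_qReg_two]
  simp only [Fintype.sum_bool, hent, norm_mul, mul_pow]
  have hA1 : ‖ketAperp fun _ : Fin 1 => true‖ ^ 2 + ‖ketAperp fun _ : Fin 1 => false‖ ^ 2 = 1 := by
    have := sum_star_ketAperp_mul_ketAperp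
    rw [sum_qReg_one, Fintype.sum_bool] at this
    have e : ∀ z : ℂ, star z * z = ((‖z‖ ^ 2 : ℝ) : ℂ) := fun z => by
      rw [Complex.star_def, Complex.conj_mul', Complex.ofReal_pow]
    rw [e, e, ← Complex.ofReal_add] at this
    exact_mod_cast this
  -- collect: `Σ_h |s_h|² · (Σ_c |A⊥(c)|²) = Σ_h |s_h|²`
  have hcollect : ∀ p q s t : ℝ, p + q = 1 → p * s + p * t + (q * s + q * t) = s + t := by
    intro p q s t hpq; linear_combination (s + t) * hpq
  rw [hcollect _ _ _ _ hA1]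
  -- evaluate `s_0`, `s_1`: all constants become real multiples of `1` and `i`
  have hinv : (invSqrt2 : ℂ) = ((Real.sqrt 2 / 2 : ℝ) : ℂ) := by
    rw [show (invSqrt2 : ℂ) = ((Real.sqrt 2 : ℝ) : ℂ)⁻¹ by simp [invSqrt2], inv_sqrt2_eq]; push_cast; ring
  have homega : omega = ((Real.sqrt 2 / 2 : ℝ) : ℂ) * (1 + Complex.I) := by rw [omega_eq_sqrt]; ring
  simp only [ketAperp_false, ketAperp_true, star_neg, star_mul', Complex.sq_norm]
  rw [homega, hinv]
  simp only [Complex.star_def, map_mul, map_add, Complex.conj_ofReal, Complex.conj_I, map_one]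
  simp only [gamma, gadgetInt, Matrix.cons_val_zero, Matrix.cons_val_one]
  simp only [Complex.normSq_apply, Complex.add_re, Complex.add_im, Complex.mul_re, Complex.mul_im, Complex.neg_re,
    Complex.neg_im, Complex.div_ofNat_re, Complex.div_ofNat_im, Complex.I_re, Complex.I_im, Complex.intCast_re,
    Complex.intCast_im, Complex.ofReal_re, Complex.ofReal_im, Complex.one_re, Complex.one_im]
  have h2 : Real.sqrt 2 ^ 2 = 2 := Real.sq_sqrt (by norm_num)
  have h3 : Real.sqrt 2 ^ 3 = 2 * Real.sqrt 2 := by rw [pow_succ, h2]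
  have h4 : Real.sqrt 2 ^ 4 = 4 := by rw [show (4 : ℕ) = 2 + 2 from rfl, pow_add, h2]; norm_num
  ring_nf
  rw [h2, h3, h4]
  ring

/-- **The bound used by the reduction**: `‖Π_⊥ γ‖² ≤ 3/1000` (since `√2 ≥ 1.4137`). [cite: AaronsonAmbainis2018, §6 Lemma 24 (p. 26)] -/
theorem normSq_branchPerp_le : normSq branchPerp ≤ 3 / 1000 := by
  rw [normSq_branchPerp_eq]
  have h : (14137 : ℝ) / 10000 ≤ Real.sqrt 2 := by
    rw [Real.le_sqrt (by norm_num) (by norm_num)]; norm_num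
  linarith

/-- Consequently the `|A⟩`-branch carries weight at least `997/1000`. [cite: AaronsonAmbainis2018, §6 Lemma 24 (p. 26)] -/
theorem normSq_branchA_ge : 997 / 1000 ≤ normSq branchA := by
  have := normSq_branchA_add; have := normSq_branchPerp_le; linarith

/-- Both weights are nonnegative. [folklore] -/
theorem normSq_nonneg' {n : ℕ} (φ : QReg n → ℂ) : 0 ≤ normSq φ :=
  Finset.sum_nonneg fun _ _ => by positivity

end Lemma24

end Literature.Computability.QuantumComplexity

end
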